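import Summits.QuantumFields.BalabanUV.Beta.EriceFlowEnclosureB12AsPrintedPointwiseFadingRunRows

/-!
# Beta / EriceFlowEnclosureB12AsPrintedPointwiseFadingRunRowsNecessity — part 12d: THE DECIDING CRUX'S ROW (iv) FORCES `0 ≤ b⋆`.
# Converse direction of part 12: under node U2's moduli + NE4 (so that part 11's ONE asymptotic number `b⋆` exists), the RUN-WISE partial-sum floor of K1⁸'s rows — (iv)
# `∀ n gs, RGEqH n β gs → Step.InInterval γ₀ n gs → ∀ k ≤ n, −M ≤ Σ_{j∈[k,n)} β_{j+1}(gs_{≤j})` at ANY ONE level `γ₀ > 0` — forces **`0 ≤ b⋆`**: if `b⋆ < 0`, the sandwich makes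
# `β_{k+1} ≤ b⋆∕2 < 0` from some scale on in a small box, and the clamped forward run started deep enough (`1∕g₀² = 1∕δ² + k₀·B`) is a genuine solution of (0.20) of EVERY depth
# staying in the box, along which the window sums from `k₀` drift to `−∞` (pub-balaban-gaps' shooting `Y`, `rgEqH_shoot_of_survives`, `windowSum_shoot` BY NAME).  With part 12
# (`0 < b⋆` ⟹ (iv)) and part 12c (`b⋆ = 0`: (iv) can fail) this prices K1⁸'s lower row against the β-flow team's one number exactly: **b⋆ > 0 sufficient, b⋆ ≥ 0 necessary,
# b⋆ = 0 undecided by the letters.**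
# (β-flow team, prover 2 = lower ∕ positivity side, unit `b2b-balaban-beta-bflow-p2`, gen 50; necessity part of part 12)

HONEST FRAMING (page 1 of everything the β sub-cell writes): discharging `BetaPertH` makes Bałaban's UV stability UNCONDITIONAL — a
real constructive-QFT result; it is NOT the continuum limit and NOT the Clay problem.  HONEST DEPENDENCY (cell reorg 2026-08-19,
verbatim): «continuum YM on T⁴ ⇐ BetaPertH ∧ nine spine estimates (0/9 proved); BetaPertH ⇐ (D1) ∧ (D4) ∧ CAP+tail; G-an2-4 gates
asym, D1 and NE2/3/4.»  THIS MODULE DISCHARGES NOTHING: [folklore] shooting ∕ finite-sum bookkeeping for an ABSTRACT `β : FlowStep.HBeta` under node U2's HYPOTHESIS SHAPES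
`T4CouplingMatching.HistLipschitz ∕ FadingMemory ∕ ScaleShiftRate` (NOT printed — [Balaban1987RG1] p. 298 ∕ p. 264; GAPS G-t4-U2-1∕2) and a DISPLAYED run-wise floor; part 11's
`exists_sandwich` ∕ `abs_beta_sub_bstar_le`, part 11h's `slope_le_bstar_of_betaAvgAFH`, the tree's shooting table `FlowStep.{Y, gClamp, clampPrefix, Y_zero, Y_succ', clampPrefix_mem_box}`
and pub-balaban-gaps' `Gaps.EndRunwiseShooting.{rgEqH_shoot_of_survives, inInterval_shoot, windowSum_shoot}` consumed BY NAME.  Nothing is asserted about Bałaban's β-functions (1.22).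

WHAT THIS FILE PROVES (0 sorry, 0 def):
§1 **`survives_of_eventual_neg`** (a box ceiling `B` at all scales + `β_{k+1} ≤ −ε` from scale `k₀` on ⟹ the clamped run from `1∕g₀² = 1∕δ² + k₀B` never meets the clamp and climbs by `ε`
   per scale after `k₀`), **`no_runPS_of_eventual_neg`** (⟹ at that level NO run-wise partial-sum floor, for any M).
§2 **`bstar_nonneg_of_runPS`** (moduli + NE4 + `b⋆` + row (iv) at SOME level ⟹ `0 ≤ b⋆`), `bstar_nonneg_of_rowsTriple` (K1⁸'s rows ∃-shape over β ⟹ `0 ≤ b⋆`),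
   `bstar_nonneg_of_betaPartialSumsLowerH` (the all-histories END grade inside ]0, γ] ⟹ `0 ≤ b⋆`, part 11h BY NAME), `no_rowsTriple_of_bstar_neg`.
NOT CLAIMED: anything at `b⋆ = 0` (undecided: part 12c's toy vs. `β ≡ 0`); anything about Bałaban's β; K1⁸; `BetaPertH`; continuum; Clay.
-/

namespace Summit.QuantumFields.BalabanUV.Beta.EriceFlowEnclosureB12AsPrintedPointwiseFadingRunRowsNecessity

open Finset
open Literature.MathematicalPhysics.QuantumFieldTheory.Balaban1983to89
open Literature.MathematicalPhysics.QuantumFieldTheory.Balaban1983to89.FlowStep (HBeta prefixOf Box mem_box box_mono RGEqH Y gClamp clampPrefix Y_zero Y_succ'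
  clampPrefix_mem_box)
open Literature.MathematicalPhysics.QuantumFieldTheory.Balaban1983to89.FlowStepRuns (BetaPartialSumsLowerH)
open Literature.MathematicalPhysics.QuantumFieldTheory.Balaban1983to89.T4CouplingMatching (HistLipschitz FadingMemory ScaleShiftRate)
open Literature.MathematicalPhysics.QuantumFieldTheory.Balaban1983to89.T4BetaStationary (betaInf constant_nonneg_of_scaleShiftRate)
open Literature.MathematicalPhysics.QuantumFieldTheory.Balaban1983to89.Beta.AveragedAFCarrier (BetaAvgAFH)
open Summit.QuantumFields.BalabanUV.Gaps.EndRunwiseShooting (rgEqH_shoot_of_survives inInterval_shoot windowSum_shoot)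
open Summit.QuantumFields.BalabanUV.Beta.EriceFlowEnclosureB12AsPrintedPointwiseFadingLimit (abs_beta_sub_bstar_le exists_sandwich)
open Summit.QuantumFields.BalabanUV.Beta.EriceFlowEnclosureB12AsPrintedPointwiseFadingLimitCarrier (slope_le_bstar_of_betaAvgAFH)

noncomputable section

section Generic

variable {β : HBeta}

/-! ## §1 An eventually negative family has, at that level, a run of every depth drifting to `1∕g² = +∞` -/

/-- **THE DEEP SURVIVOR.**  At a level `δ > 0` suppose a ceiling `β_{k+1} ≤ B` (`0 ≤ B`) on all boxes and `β_{k+1} ≤ −ε` (`0 ≤ ε`) on the boxes from scale `k₀` on.  Then the tree's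
clamped forward run (`FlowStep.Y`) started at `g₀ = 1∕√(1∕δ² + k₀B)`: loses at most `B` per scale up to `k₀` (`1∕δ² + (k₀ − k)B ≤ Y_k`), gains at least `ε` per scale afterwards
(`Y_{k₀} + mε ≤ Y_{k₀+m}`), hence NEVER meets the clamp (`1∕δ² ≤ Y_k` for every k) — a genuine solution of (0.20) of every depth in ]0, δ]. [cite: Balaban1987RG1, (0.20) p.256] -/
theorem survives_of_eventual_neg {δ B ε : ℝ} {k₀ : ℕ} (hδ : 0 < δ) (hB : 0 ≤ B) (hε : 0 ≤ ε)
    (hub : ∀ (k : ℕ) (v : Fin (k + 1) → ℝ), v ∈ Box δ k → β k v ≤ B)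
    (hneg : ∀ (k : ℕ) (v : Fin (k + 1) → ℝ), k₀ ≤ k → v ∈ Box δ k → β k v ≤ -ε) :
    (∀ k, k ≤ k₀ → 1 / δ ^ 2 + ((k₀ : ℝ) - k) * B ≤ Y β δ k (1 / Real.sqrt (1 / δ ^ 2 + k₀ * B))) ∧
      (∀ m : ℕ, Y β δ k₀ (1 / Real.sqrt (1 / δ ^ 2 + k₀ * B)) + m * ε ≤ Y β δ (k₀ + m) (1 / Real.sqrt (1 / δ ^ 2 + k₀ * B))) ∧
      ∀ k, 1 / δ ^ 2 ≤ Y β δ k (1 / Real.sqrt (1 / δ ^ 2 + k₀ * B)) := by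
  set g₀ : ℝ := 1 / Real.sqrt (1 / δ ^ 2 + k₀ * B) with hg₀
  have hpos : 0 < 1 / δ ^ 2 + k₀ * B := by positivity
  have hY0 : Y β δ 0 g₀ = 1 / δ ^ 2 + k₀ * B := by
    rw [Y_zero, hg₀, div_pow, one_pow, Real.sq_sqrt hpos.le, one_div_one_div]
  have h1 : ∀ k, k ≤ k₀ → 1 / δ ^ 2 + ((k₀ : ℝ) - k) * B ≤ Y β δ k g₀ := by
    intro k
    induction k with
    | zero => intro _; rw [hY0]; simp
    | succ k ih =>
      intro hk
      have h := ih (Nat.le_of_succ_le hk)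
      have hb := hub k _ (clampPrefix_mem_box (β := β) hδ k g₀)
      rw [Y_succ']
      push_cast
      nlinarith
  have hk₀ : 1 / δ ^ 2 ≤ Y β δ k₀ g₀ := by
    have := h1 k₀ le_rfl
    simpa using this
  have h2 : ∀ m : ℕ, Y β δ k₀ g₀ + m * ε ≤ Y β δ (k₀ + m) g₀ := by
    intro m
    induction m with
    | zero => simp
    | succ m ih =>
      have hn := hneg (k₀ + m) _ (Nat.le_add_right _ _) (clampPrefix_mem_box (β := β) hδ (k₀ + m) g₀)
      rw [← add_assoc, Y_succ']
      push_cast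
      linarith
  refine ⟨h1, h2, fun k => ?_⟩
  rcases le_or_gt k k₀ with hk | hk
  · have h := h1 k hk
    have hnn : 0 ≤ ((k₀ : ℝ) - k) * B := mul_nonneg (by rw [sub_nonneg]; exact_mod_cast hk) hB
    linarith
  · obtain ⟨m, rfl⟩ : ∃ m, k = k₀ + m := ⟨k - k₀, by omega⟩
    have h := h2 m
    have hnn : 0 ≤ (m : ℝ) * ε := by positivity
    linarith

/-- **NO RUN-WISE PARTIAL-SUM FLOOR AT THAT LEVEL.**  Under the hypotheses of `survives_of_eventual_neg` with `ε > 0`: for every `M` there is an in-window solution of (0.20) of some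
depth `n` at level `δ` and a scale `k ≤ n` with `Σ_{j∈[k,n)} β_{j+1} < −M` (the deep survivor, `k = k₀`, `n = k₀ + m` with `mε > M`; `windowSum_shoot` BY NAME).
[cite: Balaban1987RG1, (0.20) p.256 and Thm 2 p.259] -/
theorem no_runPS_of_eventual_neg {δ B ε : ℝ} {k₀ : ℕ} (hδ : 0 < δ) (hB : 0 ≤ B) (hε : 0 < ε)
    (hub : ∀ (k : ℕ) (v : Fin (k + 1) → ℝ), v ∈ Box δ k → β k v ≤ B)
    (hneg : ∀ (k : ℕ) (v : Fin (k + 1) → ℝ), k₀ ≤ k → v ∈ Box δ k → β k v ≤ -ε) (M : ℝ) :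
    ∃ (n : ℕ) (gs : ℕ → ℝ), RGEqH n β gs ∧ Step.InInterval δ n gs ∧
      ∃ k, k ≤ n ∧ ∑ j ∈ Ico k n, β j (prefixOf gs j) < -M := by
  obtain ⟨-, h2, hsurv⟩ := survives_of_eventual_neg hδ hB hε.le hub hneg
  set g₀ : ℝ := 1 / Real.sqrt (1 / δ ^ 2 + k₀ * B)
  obtain ⟨m, hm⟩ := exists_nat_gt (M / ε)
  have hmε : M < m * ε := by rwa [div_lt_iff₀ hε] at hm
  refine ⟨k₀ + m, fun i => gClamp δ (Y β δ i g₀), rgEqH_shoot_of_survives hδ fun k _ => hsurv k, inInterval_shoot hδ _ _,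
    k₀, Nat.le_add_right _ _, ?_⟩
  rw [windowSum_shoot k₀ (k₀ + m) (Nat.le_add_right _ _) g₀]
  have h := h2 m
  linarith

end Generic

/-! ## §2 Under the moduli + NE4: row (iv) at any level forces `0 ≤ b⋆` -/

section Letters

variable {β : HBeta} {γ C c θ : ℝ} {Λ : ℕ → ℕ → ℝ}

/-- **K1⁸'s ROW (iv) FORCES `0 ≤ b⋆`.**  Under node U2's `HistLipschitz Λ γ β` + `FadingMemory C θ Λ` + NE4 `ScaleShiftRate c θ γ β` (0 ≤ θ < 1, 0 ≤ C, 0 < γ) and part 11's asymptotic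
constant `b⋆` (`hb`): if at SOME level `γ₀ > 0` the run-wise partial-sum floor `−M` holds along every in-window solution of (0.20), then `0 ≤ b⋆`.  (If `b⋆ < 0`: part 11's
`exists_sandwich` with `ε = −b⋆∕2` gives `β_{k+1} ≤ b⋆∕2` from some `k₀` on in a box ]0, δ], the sandwich at all scales gives the ceiling `2Cδ∕(1−θ) + c∕(1−θ)`, and §1's deep survivor at
level `min(δ, γ₀)` violates the floor.) [cite: Balaban1987RG1, Thm 2 p.259 with (0.20) p.256 and §5 p.298] -/
theorem bstar_nonneg_of_runPS (hL : HistLipschitz Λ γ β) (hΛ : FadingMemory C θ Λ) (hS : ScaleShiftRate c θ γ β)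
    (hθ0 : 0 ≤ θ) (hθ1 : θ < 1) (hC : 0 ≤ C) (hγ : 0 < γ) {bstar : ℝ}
    (hb : ∀ u : ℝ, 0 < u → u ≤ γ → |betaInf β (fun _ : ℕ => u) - bstar| ≤ C * u / (1 - θ))
    {γ₀ M : ℝ} (hγ₀ : 0 < γ₀)
    (hps : ∀ (n : ℕ) (gs : ℕ → ℝ), RGEqH n β gs → Step.InInterval γ₀ n gs →
      ∀ k, k ≤ n → -M ≤ ∑ j ∈ Ico k n, β j (prefixOf gs j)) :
    0 ≤ bstar := by
  by_contra hlt
  push Not at hlt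
  have h1θ : 0 < 1 - θ := by linarith
  have hc : 0 ≤ c := constant_nonneg_of_scaleShiftRate hS hγ
  have hε : 0 < -bstar / 2 := by linarith
  obtain ⟨δ, hδ, hδγ, k₀, hsand⟩ := exists_sandwich hL hΛ hS hθ0 hθ1 hC hγ hb hε
  set δ' : ℝ := min δ γ₀ with hδ'
  have hδ'pos : 0 < δ' := lt_min hδ hγ₀
  have hδ'δ : δ' ≤ δ := min_le_left _ _
  -- ceiling at all scales on the small box, from the sandwich at level δ
  have hub : ∀ (k : ℕ) (v : Fin (k + 1) → ℝ), v ∈ Box δ' k → β k v ≤ 2 * C * δ / (1 - θ) + c / (1 - θ) := by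
    intro k v hv
    have h := (abs_le.mp (abs_beta_sub_bstar_le hL hΛ hS hθ0 hθ1 hC hb hδ hδγ (box_mono hδ'δ k hv))).2
    have hθk : θ ^ k ≤ 1 := pow_le_one₀ hθ0 hθ1.le
    have hck : c * θ ^ k ≤ c := by nlinarith
    have hdiv : c * θ ^ k / (1 - θ) ≤ c / (1 - θ) := div_le_div_of_nonneg_right hck h1θ.le
    linarith
  have hB : 0 ≤ 2 * C * δ / (1 - θ) + c / (1 - θ) := by positivity
  -- eventual negativity on the small box
  have hneg : ∀ (k : ℕ) (v : Fin (k + 1) → ℝ), k₀ ≤ k → v ∈ Box δ' k → β k v ≤ -(-bstar / 2) := by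
    intro k v hk hv
    have h := (abs_le.mp (hsand k v hk (box_mono hδ'δ k hv))).2
    linarith
  obtain ⟨n, gs, hrg, hI, k, hk, hsum⟩ := no_runPS_of_eventual_neg hδ'pos hB hε hub hneg M
  have hI' : Step.InInterval γ₀ n gs := fun i hi => ⟨(hI i hi).1, (hI i hi).2.trans (min_le_right _ _)⟩
  have h := hps n gs hrg hI' k hk
  linarith

/-- **K1⁸'s ROWS ∃-SHAPE OVER β FORCES `0 ≤ b⋆`** (the level of the triple is arbitrary; only its row (iv) is read).  With part 12's `rowsTriple_of_moduli_NE4_bstar_pos` (`0 < b⋆` ⟹ the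
triple) and part 12c's `bstar_pos_loadBearing` (`b⋆ = 0`, no triple) this is the exact price of the deciding crux's lower row in the β-flow team's currency.
[cite: Balaban1987RG1, Thm 2 p.259, Thm 3 p.264, §1 pp.263–264, (5.10) p.293, §5 p.298] -/
theorem bstar_nonneg_of_rowsTriple (hL : HistLipschitz Λ γ β) (hΛ : FadingMemory C θ Λ) (hS : ScaleShiftRate c θ γ β)
    (hθ0 : 0 ≤ θ) (hθ1 : θ < 1) (hC : 0 ≤ C) (hγ : 0 < γ) {bstar : ℝ}
    (hb : ∀ u : ℝ, 0 < u → u ≤ γ → |betaInf β (fun _ : ℕ => u) - bstar| ≤ C * u / (1 - θ))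
    (hrows : ∃ (b : ℕ → ℝ) (r γ₀ M : ℝ), 0 < γ₀ ∧
      (∀ (n : ℕ) (gs : ℕ → ℝ), RGEqH n β gs → Step.InInterval γ₀ n gs → ∀ k, k ≤ n → |β k (prefixOf gs k) - b k| ≤ r) ∧
      (∀ (n : ℕ) (gs : ℕ → ℝ), RGEqH n β gs → Step.InInterval γ₀ n gs →
        ∀ k, k ≤ n → -M ≤ ∑ j ∈ Ico k n, β j (prefixOf gs j)) ∧
      ∀ k : ℕ, ContinuousOn (fun x : ℝ => β k (clampPrefix β γ₀ k x))
        {x : ℝ | 0 < x ∧ x ≤ γ₀ ∧ ∀ j, j ≤ k → 1 / γ₀ ^ 2 ≤ Y β γ₀ j x}) :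
    0 ≤ bstar := by
  obtain ⟨-, -, γ₀, M, hγ₀, -, hps, -⟩ := hrows
  exact bstar_nonneg_of_runPS hL hΛ hS hθ0 hθ1 hC hγ hb hγ₀ hps

/-- **THE ALL-HISTORIES END GRADE FORCES `0 ≤ b⋆` TOO** — already by part 11h: `BetaPartialSumsLowerH D γ₀ β` IS crew CAP's carrier at slope 0 (`BetaAvgAFH.zero_iff`), and every
certified slope is `≤ b⋆` (`slope_le_bstar_of_betaAvgAFH` BY NAME; NE4 + `b⋆` only, no modulus needed). [cite: Balaban1987RG1, Thm 2 p.259 and §1 p.264] -/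
theorem bstar_nonneg_of_betaPartialSumsLowerH (hS : ScaleShiftRate c θ γ β) (hθ0 : 0 ≤ θ) (hθ1 : θ < 1) (hC : 0 ≤ C) {bstar : ℝ}
    (hb : ∀ u : ℝ, 0 < u → u ≤ γ → |betaInf β (fun _ : ℕ => u) - bstar| ≤ C * u / (1 - θ))
    {D γ₀ : ℝ} (hps : BetaPartialSumsLowerH D γ₀ β) (hγ₀ : 0 < γ₀) (hγ₀γ : γ₀ ≤ γ) : 0 ≤ bstar :=
  slope_le_bstar_of_betaAvgAFH hS hθ0 hθ1 hC hb (BetaAvgAFH.zero_iff.mpr hps) hγ₀ hγ₀γ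

/-- **`b⋆ < 0` ⟹ NO ROWS AT ANY LEVEL**: under the moduli + NE4, a negative asymptotic constant refutes K1⁸'s rows ∃-shape for β (contrapositive of `bstar_nonneg_of_rowsTriple`).
[cite: Balaban1987RG1, Thm 2 p.259, Thm 3 p.264, §1 pp.263–264, (5.10) p.293] -/
theorem no_rowsTriple_of_bstar_neg (hL : HistLipschitz Λ γ β) (hΛ : FadingMemory C θ Λ) (hS : ScaleShiftRate c θ γ β)
    (hθ0 : 0 ≤ θ) (hθ1 : θ < 1) (hC : 0 ≤ C) (hγ : 0 < γ) {bstar : ℝ}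
    (hb : ∀ u : ℝ, 0 < u → u ≤ γ → |betaInf β (fun _ : ℕ => u) - bstar| ≤ C * u / (1 - θ)) (hneg : bstar < 0) :
    ¬ ∃ (b : ℕ → ℝ) (r γ₀ M : ℝ), 0 < γ₀ ∧
      (∀ (n : ℕ) (gs : ℕ → ℝ), RGEqH n β gs → Step.InInterval γ₀ n gs → ∀ k, k ≤ n → |β k (prefixOf gs k) - b k| ≤ r) ∧
      (∀ (n : ℕ) (gs : ℕ → ℝ), RGEqH n β gs → Step.InInterval γ₀ n gs →
        ∀ k, k ≤ n → -M ≤ ∑ j ∈ Ico k n, β j (prefixOf gs j)) ∧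
      ∀ k : ℕ, ContinuousOn (fun x : ℝ => β k (clampPrefix β γ₀ k x))
        {x : ℝ | 0 < x ∧ x ≤ γ₀ ∧ ∀ j, j ≤ k → 1 / γ₀ ^ 2 ≤ Y β γ₀ j x} :=
  fun h => absurd (bstar_nonneg_of_rowsTriple hL hΛ hS hθ0 hθ1 hC hγ hb h) (not_le.mpr hneg)

end Letters

end

end Summit.QuantumFields.BalabanUV.Beta.EriceFlowEnclosureB12AsPrintedPointwiseFadingRunRowsNecessity
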